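import Summits.CriticalPhenomena.PercolationContinuityZ3.Theorems.PercNearOneGluingNoHeavyQuantGluedShareDual
import Summits.CriticalPhenomena.PercolationContinuityZ3.Theorems.PercNearOneGluingNoHeavyQuantGluedCheapPool
import HarnessLib

/-!
# QUANT lane R8, T-DEC: LEMMA W's pair condition in the two-row regime, h a MID — REDUCTION TO A SHARE CERTIFICATE: all pricing, pullback and
# cheap-pool bookkeeping done once; what is left per cell is a fractional assignment of four capacities to two rows (arm-1 gen 60, architect)

builds on p205010 (kernel theorem, internal audit signed; external expert review pending)

Support file (`--supports stmt-CriticalPhenomena-4575`), QUANT lane seat prim-quant-arm-1 (gen 60, architect); memo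
`run/shared/lean/prim/quant/prim-quant-arm-1-g60/ARCH-G60.md` §1–§4.  Theorems only; standard axioms, no sorries, no definitions.

THE REGIME.  Band frame and price system of `gluedPullback_windowPair_of_lemmaW` (`…QuantGluedLemmaW`); light window pair `(l, h)`; the TWO-ROW regime
(`2(l+r) < T ≤ 2(l+r+k)`, `l+r+k ≤ j`: the bottom and middle copies of `l` are the rows, its top copy `A = l+r+k` is a priced mid column) with `h` a MID
(`T ≤ 2h`; ≈ 87 % of the regime's window pairs, survey kit j297905): the other columns are `H = h` (capacity `γt₀`), `G = h+r` (capacity `γt₁`; a mid if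
`h+r ≤ j`, else a giant and then merged into the pool: `ι = 1`) and the POOL = the giant `h+r+k` (+ `h+r` when `ι = 1`), priced at the least giant price
`P`, into which — `c ≥ h` being CHEAP w.r.t. a low `l*` — every low `w` ships at the discounted rate `min(u, usage(w,h))` (`pool_bound`, `usage_anti_mid`).
THE THEOREM **`gluedPullback_windowPair_twoRow_mid_of_assign`**: for ANY numbers `ϖ i b ≥ 0` (inverse-rate bounds: `ϖ·usage(row i, column b) ≤ 1`, or
`ϖ = 0` for an incompatible pair; for the pool `ϖ·u ≤ 1` or, when the row is compatible with `h`, `ϖ·usage(row, h) ≤ 1`) and shares `s i b ≥ 0` with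
`s 0 b + s 1 b ≤ 1` such that the two COVERAGE inequalities `w i ≤ Σ_b s i b · cap b · ϖ i b` hold (`w = (1−γ)(t₀, t₁)`), the pair condition
`(1−γ)Ψ(l) + γΨ(h) ≤ 0` holds.  **`…_of_share`**: the uniform shares `(σ, 1−σ)`.  So every h-mid cell of LEMMA W is now PURE REAL ALGEBRA: choose `ϖ`
from `GluedWindow.apow_heavy_valid` / `apow_light_valid` (TANGENT bound) / `apow_giant_valid` by the cell's flags and prove two inequalities; the exact
rational census kit j301043/j301047 (`--workitem 4575`) finds the uniform share sufficient in EVERY sampled h-mid configuration (memo §3: table of the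
96 flag patterns with minimal slacks; no θ-order enters).

HONEST STATUS.  `GluedLemmaW` (flow form), `GluedDominatedMass`, the band, `SiblingStep`, `FarTreeRow` OPEN; RATE class (log\*) / honest sentence of
`run/shared/lean/prim/quant/README.md` unchanged.  [this work].  Nothing here is cited as a published result.  The gluing rows served
[cite: KozmaNitzan2024, Conjecture 3 (p. 15)]; product measure [cite: Grimmett1999, §1.3 p. 10].
-/

set_option maxHeartbeats 4000000

noncomputable section

open scoped BigOperators

namespace Summit.CriticalPhenomena.PercolationContinuityZ3.Theorems
namespace Quant

open Finset

namespace LawDec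

/-- **TWO-ROW REGIME, h A MID: THE PAIR CONDITION FROM AN ASSIGNMENT CERTIFICATE.**  Rows `l` (weight `(1−γ)t₀`) and `l+r` (weight `(1−γ)t₁`); columns
`A = l+r+k` (capacity `(1−γ)t₂`), `H = h` (`γt₀`), `G = h+r` (`γt₁(1−ι)`), pool (`γ(t₂ + ιt₁)`), `ι = [j < h+r]`; inverse-rate bounds `ϖ`, shares `s`;
see the file header. [this work] -/
theorem gluedPullback_windowPair_twoRow_mid_of_assign (x a q g S : ℝ) (B r k j l h c ls : ℕ) (α p : ℕ → ℝ) (ι : ℝ)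
    (ϖ0A ϖ0H ϖ0G ϖ0P ϖ1A ϖ1H ϖ1G ϖ1P s0A s0H s0G s0P s1A s1H s1G s1P : ℝ)
    (hx0 : 0 < x) (hx1 : x < 1) (ha0 : 0 < a) (ha1 : a ≤ 1) (hq0 : 0 < q) (hq1 : q < 1) (hg0 : 0 ≤ g) (hg1 : g ≤ 1) (hr : 1 ≤ r)
    (hlh : l < h) (hhB : h ≤ B) (hwin : j < h + r + k) (hlow : 2 * (l : ℝ) < a * S) (hcomp : a * S < (l : ℝ) + h)
    (hL2j : l + r + k ≤ j) (hL2mid : a * (S + q * ((r : ℝ) + k * g)) ≤ 2 * ((l : ℝ) + r + k))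
    (hL1low : 2 * ((l : ℝ) + r) < a * (S + q * ((r : ℝ) + k * g))) (hhmid : a * (S + q * ((r : ℝ) + k * g)) ≤ 2 * (h : ℝ))
    (hι : (h + r ≤ j ∧ ι = 0) ∨ (j < h + r ∧ ι = 1))
    (hhc : h ≤ c) (hcB : c ≤ B) (hcj : c ≤ j)
    (hp : ∀ h, 0 ≤ p h)
    (hαp : ∀ l' h', l' ≤ j → 2 * (l' : ℝ) < a * (S + q * ((r : ℝ) + k * g)) → h' ≤ B + (r + k) →
      (j + 1 ≤ h' ∨ a * (S + q * ((r : ℝ) + k * g)) < (l' : ℝ) + h') →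
      α l' ≤ usage (a * x) (a * (S + q * ((r : ℝ) + k * g))) j l' h' * p h')
    (hcheap : -(gluedPullback (a * (S + q * ((r : ℝ) + k * g))) q g j r k α p c) * (a * x)
      < (1 - a * x) * gluedPullback (a * (S + q * ((r : ℝ) + k * g))) q g j r k α p ls)
    -- the certificate: nonnegativity and column sums
    (hϖ0A : 0 ≤ ϖ0A) (hϖ0H : 0 ≤ ϖ0H) (hϖ0G : 0 ≤ ϖ0G) (hϖ0P : 0 ≤ ϖ0P) (hϖ1A : 0 ≤ ϖ1A) (hϖ1H : 0 ≤ ϖ1H) (hϖ1G : 0 ≤ ϖ1G) (hϖ1P : 0 ≤ ϖ1P)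
    (hs0A : 0 ≤ s0A) (hs0H : 0 ≤ s0H) (hs0G : 0 ≤ s0G) (hs0P : 0 ≤ s0P) (hs1A : 0 ≤ s1A) (hs1H : 0 ≤ s1H) (hs1G : 0 ≤ s1G) (hs1P : 0 ≤ s1P)
    (hSA : s0A + s1A ≤ 1) (hSH : s0H + s1H ≤ 1) (hSG : s0G + s1G ≤ 1) (hSP : s0P + s1P ≤ 1)
    -- validity of the inverse-rate bounds (row 0 = l, row 1 = l + r)
    (hv0A : ϖ0A * usage (a * x) (a * (S + q * ((r : ℝ) + k * g))) j l (l + r + k) ≤ 1)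
    (hc0A : ϖ0A = 0 ∨ a * (S + q * ((r : ℝ) + k * g)) < (l : ℝ) + ((l : ℝ) + r + k))
    (hv0H : ϖ0H * usage (a * x) (a * (S + q * ((r : ℝ) + k * g))) j l h ≤ 1)
    (hc0H : ϖ0H = 0 ∨ a * (S + q * ((r : ℝ) + k * g)) < (l : ℝ) + h)
    (hv0G : ϖ0G * usage (a * x) (a * (S + q * ((r : ℝ) + k * g))) j l (h + r) ≤ 1)
    (hc0G : ϖ0G = 0 ∨ j < h + r ∨ a * (S + q * ((r : ℝ) + k * g)) < (l : ℝ) + ((h : ℝ) + r))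
    (hv0P : ϖ0P * ((a * x) / (1 - a * x)) ≤ 1 ∨
      (a * (S + q * ((r : ℝ) + k * g)) < (l : ℝ) + h ∧ ϖ0P * usage (a * x) (a * (S + q * ((r : ℝ) + k * g))) j l h ≤ 1))
    (hv1A : ϖ1A * usage (a * x) (a * (S + q * ((r : ℝ) + k * g))) j (l + r) (l + r + k) ≤ 1)
    (hc1A : ϖ1A = 0 ∨ a * (S + q * ((r : ℝ) + k * g)) < ((l : ℝ) + r) + ((l : ℝ) + r + k))
    (hv1H : ϖ1H * usage (a * x) (a * (S + q * ((r : ℝ) + k * g))) j (l + r) h ≤ 1)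
    (hc1H : ϖ1H = 0 ∨ a * (S + q * ((r : ℝ) + k * g)) < ((l : ℝ) + r) + h)
    (hv1G : ϖ1G * usage (a * x) (a * (S + q * ((r : ℝ) + k * g))) j (l + r) (h + r) ≤ 1)
    (hc1G : ϖ1G = 0 ∨ j < h + r ∨ a * (S + q * ((r : ℝ) + k * g)) < ((l : ℝ) + r) + ((h : ℝ) + r))
    (hv1P : ϖ1P * ((a * x) / (1 - a * x)) ≤ 1 ∨
      (a * (S + q * ((r : ℝ) + k * g)) < ((l : ℝ) + r) + h ∧ ϖ1P * usage (a * x) (a * (S + q * ((r : ℝ) + k * g))) j (l + r) h ≤ 1))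
    -- coverage of the two rows
    (hcov0 : (1 - pairGate (a * x) (a * S) l h) * (1 - q)
      ≤ s0A * ((1 - pairGate (a * x) (a * S) l h) * (q * g) * ϖ0A) + s0H * (pairGate (a * x) (a * S) l h * (1 - q) * ϖ0H)
        + s0G * (pairGate (a * x) (a * S) l h * (q * (1 - g)) * (1 - ι) * ϖ0G)
        + s0P * (pairGate (a * x) (a * S) l h * (q * g + ι * (q * (1 - g))) * ϖ0P))
    (hcov1 : (1 - pairGate (a * x) (a * S) l h) * (q * (1 - g))
      ≤ s1A * ((1 - pairGate (a * x) (a * S) l h) * (q * g) * ϖ1A) + s1H * (pairGate (a * x) (a * S) l h * (1 - q) * ϖ1H)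
        + s1G * (pairGate (a * x) (a * S) l h * (q * (1 - g)) * (1 - ι) * ϖ1G)
        + s1P * (pairGate (a * x) (a * S) l h * (q * g + ι * (q * (1 - g))) * ϖ1P)) :
    (1 - pairGate (a * x) (a * S) l h) * gluedPullback (a * (S + q * ((r : ℝ) + k * g))) q g j r k α p l
      + pairGate (a * x) (a * S) l h * gluedPullback (a * (S + q * ((r : ℝ) + k * g))) q g j r k α p h ≤ 0 := by
  set y : ℝ := a * x with hy
  set T : ℝ := a * (S + q * ((r : ℝ) + k * g)) with hT
  set T₀ : ℝ := a * S with hT₀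
  set γ : ℝ := pairGate (a * x) (a * S) l h with hγ
  set t0 : ℝ := 1 - q with ht0
  set t1 : ℝ := q * (1 - g) with ht1
  set t2 : ℝ := q * g with ht2
  have hy0 : 0 < y := by rw [hy]; exact mul_pos ha0 hx0
  have hyx : y ≤ x := by rw [hy]; nlinarith
  have hy1 : y < 1 := by linarith
  have h1y : 0 < 1 - y := by linarith
  have hu0 : 0 ≤ y / (1 - y) := div_nonneg hy0.le h1y.le
  have ht0p : 0 ≤ t0 := by rw [ht0]; linarith
  have ht1p : 0 ≤ t1 := by rw [ht1]; exact mul_nonneg hq0.le (by linarith)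
  have ht2p : 0 ≤ t2 := by rw [ht2]; exact mul_nonneg hq0.le hg0
  -- the gate γ ∈ (0, 1)
  have hγ0 : 0 < γ := by rw [hγ]; exact pairGate_pos (a * x) (a * S) l h hlow hlh
  have hγ1 : γ < 1 := by rw [hγ]; exact pairGate_lt_one (a * x) (a * S) l h hy0 hy1 hlow hcomp
  have h1γ : 0 ≤ 1 - γ := by linarith
  -- T₀ ≤ T
  have hΔ0 : T₀ ≤ T := by rw [hT, hT₀]; nlinarith [mul_nonneg ha0.le (show (0:ℝ) ≤ q * ((r:ℝ) + k * g) by positivity)]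
  have hr0 : (0:ℝ) ≤ r := Nat.cast_nonneg r
  have hk0 : (0:ℝ) ≤ k := Nat.cast_nonneg k
  have hlh' : (l : ℝ) < h := by exact_mod_cast hlh
  -- statuses
  have hL0 : l ≤ j ∧ 2 * (l : ℝ) < T := ⟨by omega, by linarith⟩
  have hL1 : l + r ≤ j ∧ 2 * ((l + r : ℕ) : ℝ) < T := ⟨by omega, by push_cast; linarith⟩
  have hL2n : ¬ (l + r + k ≤ j ∧ 2 * ((l + r + k : ℕ) : ℝ) < T) := by push_cast; intro hh; linarith [hh.2]
  have nonlow : ∀ v : ℕ, h ≤ v → ¬ (v ≤ j ∧ 2 * (v : ℝ) < T) := by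
    intro v hv ⟨_, hv2⟩
    have : (h : ℝ) ≤ v := by exact_mod_cast hv
    linarith
  have cL : ∀ v : ℕ, (v ≤ j ∧ 2 * (v : ℝ) < T) → coefAt T j α p v = α v := fun v hv => by simp only [coefAt, if_pos hv]
  have cN : ∀ v : ℕ, ¬ (v ≤ j ∧ 2 * (v : ℝ) < T) → coefAt T j α p v = -p v := fun v hv => by simp only [coefAt, if_neg hv]
  have eΨl : gluedPullback T q g j r k α p l = t0 * α l + t1 * α (l + r) - t2 * p (l + r + k) := by
    simp only [gluedPullback, cL l hL0, cL (l + r) hL1, cN (l + r + k) hL2n, ht0, ht1, ht2]; ring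
  have eΨh : gluedPullback T q g j r k α p h = -(t0 * p h + t1 * p (h + r) + t2 * p (h + r + k)) := by
    simp only [gluedPullback, cN h (nonlow h le_rfl), cN (h + r) (nonlow _ (by omega)), cN (h + r + k) (nonlow _ (by omega)), ht0, ht1, ht2]
    ring
  have eΨc : gluedPullback T q g j r k α p c = -(t0 * p c + t1 * p (c + r) + t2 * p (c + r + k)) := by
    simp only [gluedPullback, cN c (nonlow c hhc), cN (c + r) (nonlow _ (by omega)), cN (c + r + k) (nonlow _ (by omega)), ht0, ht1, ht2]; ring
  -- the pool price P = least price among the giants {h+r+k, c+r+k, (h+r if > j), (c+r if > j)}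
  obtain ⟨q1, hq1d⟩ : ∃ q1 : ℝ, q1 = if h + r ≤ j then p (h + r + k) else p (h + r) := ⟨_, rfl⟩
  obtain ⟨q2, hq2d⟩ : ∃ q2 : ℝ, q2 = if c + r ≤ j then p (c + r + k) else p (c + r) := ⟨_, rfl⟩
  obtain ⟨P, hP⟩ : ∃ P : ℝ, P = min (min (p (h + r + k)) (p (c + r + k))) (min q1 q2) := ⟨_, rfl⟩
  have hPH2 : P ≤ p (h + r + k) := by rw [hP]; exact le_trans (min_le_left _ _) (min_le_left _ _)
  have hPC2 : P ≤ p (c + r + k) := by rw [hP]; exact le_trans (min_le_left _ _) (min_le_right _ _)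
  have hPq1 : P ≤ q1 := by rw [hP]; exact le_trans (min_le_right _ _) (min_le_left _ _)
  have hPq2 : P ≤ q2 := by rw [hP]; exact le_trans (min_le_right _ _) (min_le_right _ _)
  have hP0 : 0 ≤ P := by
    rw [hP]; refine le_min (le_min (hp _) (hp _)) (le_min ?_ ?_)
    · rw [hq1d]; split_ifs <;> exact hp _
    · rw [hq2d]; split_ifs <;> exact hp _
  -- every "pullback ≤ u·(giant price)" instance, and the choice of the giant realising P
  have giantChoice : ∃ G : ℕ, j + 1 ≤ G ∧ G ≤ B + (r + k) ∧ P = p G := by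
    rw [hP]
    rcases min_choice (min (p (h + r + k)) (p (c + r + k))) (min q1 q2) with e | e <;> rw [e]
    · rcases min_choice (p (h + r + k)) (p (c + r + k)) with e' | e' <;> rw [e']
      · exact ⟨h + r + k, by omega, by omega, rfl⟩
      · exact ⟨c + r + k, by omega, by omega, rfl⟩
    · rcases min_choice q1 q2 with e' | e' <;> rw [e']
      · rw [hq1d]; split_ifs with hh
        · exact ⟨h + r + k, by omega, by omega, rfl⟩
        · exact ⟨h + r, by omega, by omega, rfl⟩
      · rw [hq2d]; split_ifs with hh
        · exact ⟨c + r + k, by omega, by omega, rfl⟩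
        · exact ⟨c + r, by omega, by omega, rfl⟩
  obtain ⟨G, hGj, hGM, hPG⟩ := giantChoice
  have hΨls : gluedPullback T q g j r k α p ls ≤ y / (1 - y) * P := by
    rw [hPG]; exact gluedPullback_le_giant y T q g j r k (B + (r + k)) α p hy0 hy1 hq0.le hq1.le hg0 hg1 hp hαp ls G hGj hGM
  have giantP : ∀ w : ℕ, w ≤ j → 2 * (w : ℝ) < T → α w ≤ y / (1 - y) * P := by
    intro w hwj hwl
    have := hαp w G hwj hwl hGM (Or.inl hGj)
    rwa [usage_giant_eq y T j w G hGj, ← hPG] at this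
  -- cheapness ⟹ the pool bound at the discounted rate usage(·, h)
  have havg : t0 * p c + t1 * p (c + r) + t2 * p (c + r + k) < P := by
    have := cheap_neg_pullback_lt y _ _ P hy0 hy1 hcheap hΨls
    rw [eΨc, neg_neg] at this; exact this
  have hC1 : j + 1 ≤ c + r ∧ P ≤ p (c + r) ∨ c + r ≤ j := by
    by_cases hcr : c + r ≤ j
    · exact Or.inr hcr
    · refine Or.inl ⟨by omega, ?_⟩
      have : q2 = p (c + r) := by rw [hq2d, if_neg hcr]
      rw [← this]; exact hPq2
  have poolH : ∀ w : ℕ, w ≤ j → 2 * (w : ℝ) < T → T < (w : ℝ) + h → α w ≤ usage y T j w h * P := by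
    intro w hwj hwl hwh
    have hwc : T < (w : ℝ) + c := by
      have : (h : ℝ) ≤ c := by exact_mod_cast hhc
      linarith
    have b1 : α w ≤ usage y T j w c * P := by
      refine pool_bound y T q g P j (B + (r + k)) c r k w α p hy0 hy1 hq0.le hq1.le hg0 hg1 hp hαp hwj hwl hwc (by omega) hr ?_ hPC2 hC1
      rw [ht0, ht1, ht2] at havg; exact havg
    rcases Nat.eq_or_lt_of_le hhc with hch | hch
    · rw [hch]; exact b1
    · exact le_trans b1 (mul_le_mul_of_nonneg_right (usage_anti_mid y T j w h c hy0 hy1 hch hcj hwl hwh) hP0)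
  -- prices and capacities of the four columns
  set pA : ℝ := p (l + r + k) with hpA
  set pH : ℝ := p h with hpH
  set pG : ℝ := p (h + r) with hpG
  have hpA0 : 0 ≤ pA := hp _
  have hpH0 : 0 ≤ pH := hp _
  have hpG0 : 0 ≤ pG := hp _
  have hι01 : 0 ≤ ι ∧ ι ≤ 1 := by rcases hι with ⟨_, e⟩ | ⟨_, e⟩ <;> rw [e] <;> norm_num
  set cA : ℝ := (1 - γ) * t2 with hcA
  set cH : ℝ := γ * t0 with hcH
  set cG : ℝ := γ * t1 * (1 - ι) with hcG
  set cP : ℝ := γ * (t2 + ι * t1) with hcP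
  have hcA0 : 0 ≤ cA := mul_nonneg h1γ ht2p
  have hcH0 : 0 ≤ cH := mul_nonneg hγ0.le ht0p
  have hcG0 : 0 ≤ cG := mul_nonneg (mul_nonneg hγ0.le ht1p) (by linarith [hι01.2])
  have hcP0 : 0 ≤ cP := mul_nonneg hγ0.le (by nlinarith [hι01.1, ht1p, ht2p])
  -- real forms of the positions
  have eL1 : ((l + r : ℕ) : ℝ) = (l : ℝ) + r := by push_cast; ring
  have eL2 : ((l + r + k : ℕ) : ℝ) = (l : ℝ) + r + k := by push_cast; ring
  have eH1 : ((h + r : ℕ) : ℝ) = (h : ℝ) + r := by push_cast; ring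
  have hL2M : l + r + k ≤ B + (r + k) := by omega
  have hhM : h ≤ B + (r + k) := by omega
  have hH1M : h + r ≤ B + (r + k) := by omega
  -- validity facts `π · α ≤ c · price` for the eight (row, column) pairs, π = c · ϖ
  have vA : ∀ (v : ℕ) (ϖ : ℝ), 0 ≤ ϖ → (v ≤ j ∧ 2 * (v : ℝ) < T) → ϖ * usage y T j v (l + r + k) ≤ 1 →
      (ϖ = 0 ∨ T < (v : ℝ) + ((l : ℝ) + r + k)) → cA * ϖ * α v ≤ cA * pA := by
    intro v ϖ hϖ hv hval hc
    rcases hc with e | hc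
    · rw [e, mul_zero, zero_mul]; exact mul_nonneg hcA0 hpA0
    · have hb : α v ≤ usage y T j v (l + r + k) * pA := hαp v (l + r + k) hv.1 hv.2 hL2M (Or.inr (by rw [eL2]; exact hc))
      have := GluedWindow.apow_of_usage (cA * ϖ) (usage y T j v (l + r + k)) cA (α v) pA (mul_nonneg hcA0 hϖ) hpA0 hb
        (by rw [mul_assoc]; exact le_trans (mul_le_mul_of_nonneg_left hval hcA0) (by rw [mul_one]))
      exact this
  have vH : ∀ (v : ℕ) (ϖ : ℝ), 0 ≤ ϖ → (v ≤ j ∧ 2 * (v : ℝ) < T) → ϖ * usage y T j v h ≤ 1 →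
      (ϖ = 0 ∨ T < (v : ℝ) + h) → cH * ϖ * α v ≤ cH * pH := by
    intro v ϖ hϖ hv hval hc
    rcases hc with e | hc
    · rw [e, mul_zero, zero_mul]; exact mul_nonneg hcH0 hpH0
    · have hb : α v ≤ usage y T j v h * pH := hαp v h hv.1 hv.2 hhM (Or.inr hc)
      exact GluedWindow.apow_of_usage (cH * ϖ) (usage y T j v h) cH (α v) pH (mul_nonneg hcH0 hϖ) hpH0 hb
        (by rw [mul_assoc]; exact le_trans (mul_le_mul_of_nonneg_left hval hcH0) (by rw [mul_one]))
  have vG : ∀ (v : ℕ) (ϖ : ℝ), 0 ≤ ϖ → (v ≤ j ∧ 2 * (v : ℝ) < T) → ϖ * usage y T j v (h + r) ≤ 1 →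
      (ϖ = 0 ∨ j < h + r ∨ T < (v : ℝ) + ((h : ℝ) + r)) → cG * ϖ * α v ≤ cG * pG := by
    intro v ϖ hϖ hv hval hc
    rcases hc with e | hc
    · rw [e, mul_zero, zero_mul]; exact mul_nonneg hcG0 hpG0
    · have hb : α v ≤ usage y T j v (h + r) * pG := by
        refine hαp v (h + r) hv.1 hv.2 hH1M ?_
        rcases hc with hc | hc
        · exact Or.inl (by omega)
        · exact Or.inr (by rw [eH1]; exact hc)
      exact GluedWindow.apow_of_usage (cG * ϖ) (usage y T j v (h + r)) cG (α v) pG (mul_nonneg hcG0 hϖ) hpG0 hb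
        (by rw [mul_assoc]; exact le_trans (mul_le_mul_of_nonneg_left hval hcG0) (by rw [mul_one]))
  have vP : ∀ (v : ℕ) (ϖ : ℝ), 0 ≤ ϖ → (v ≤ j ∧ 2 * (v : ℝ) < T) →
      (ϖ * (y / (1 - y)) ≤ 1 ∨ (T < (v : ℝ) + h ∧ ϖ * usage y T j v h ≤ 1)) → cP * ϖ * α v ≤ cP * P := by
    intro v ϖ hϖ hv hval
    rcases hval with hval | ⟨hc, hval⟩
    · exact GluedWindow.apow_of_usage (cP * ϖ) (y / (1 - y)) cP (α v) P (mul_nonneg hcP0 hϖ) hP0 (giantP v hv.1 hv.2)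
        (by rw [mul_assoc]; exact le_trans (mul_le_mul_of_nonneg_left hval hcP0) (by rw [mul_one]))
    · exact GluedWindow.apow_of_usage (cP * ϖ) (usage y T j v h) cP (α v) P (mul_nonneg hcP0 hϖ) hP0 (poolH v hv.1 hv.2 hc)
        (by rw [mul_assoc]; exact le_trans (mul_le_mul_of_nonneg_left hval hcP0) (by rw [mul_one]))
  have hL1' : (l + r) ≤ j ∧ 2 * (((l + r : ℕ)) : ℝ) < T := hL1
  -- the assignment criterion
  have key := GluedWindow.assign_dual_two_four (α l) (α (l + r)) ((1 - γ) * t0) ((1 - γ) * t1) cA cH cG cP pA pH pG P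
    (cA * ϖ0A) (cH * ϖ0H) (cG * ϖ0G) (cP * ϖ0P) (cA * ϖ1A) (cH * ϖ1H) (cG * ϖ1G) (cP * ϖ1P)
    s0A s0H s0G s0P s1A s1H s1G s1P hcA0 hcH0 hcG0 hcP0 hpA0 hpH0 hpG0 hP0
    hs0A hs0H hs0G hs0P hs1A hs1H hs1G hs1P hSA hSH hSG hSP
    (vA l ϖ0A hϖ0A hL0 hv0A hc0A) (vH l ϖ0H hϖ0H hL0 hv0H hc0H) (vG l ϖ0G hϖ0G hL0 hv0G hc0G) (vP l ϖ0P hϖ0P hL0 hv0P)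
    (vA (l + r) ϖ1A hϖ1A hL1 hv1A (by rw [eL1]; exact hc1A)) (vH (l + r) ϖ1H hϖ1H hL1 hv1H (by rw [eL1]; exact hc1H))
    (vG (l + r) ϖ1G hϖ1G hL1 hv1G (by rw [eL1]; exact hc1G)) (vP (l + r) ϖ1P hϖ1P hL1 (by rw [eL1]; exact hv1P))
    (mul_nonneg h1γ ht0p) (mul_nonneg h1γ ht1p)
    (by rw [hcA, hcH, hcG, hcP, ht0, ht1, ht2]; linarith [hcov0])
    (by rw [hcA, hcH, hcG, hcP, ht0, ht1, ht2]; linarith [hcov1])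
  -- the pool price is below the prices it replaces
  have hPG' : ι * P ≤ ι * pG := by
    rcases hι with ⟨_, e⟩ | ⟨hjr, e⟩
    · rw [e]; simp
    · rw [e, one_mul, one_mul]
      have : q1 = p (h + r) := by rw [hq1d, if_neg (by omega)]
      rw [hpG, ← this]; exact hPq1
  have a1 : γ * t2 * P ≤ γ * t2 * p (h + r + k) := mul_le_mul_of_nonneg_left hPH2 (mul_nonneg hγ0.le ht2p)
  have a2 : γ * t1 * (ι * P) ≤ γ * t1 * (ι * pG) := mul_le_mul_of_nonneg_left hPG' (mul_nonneg hγ0.le ht1p)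
  rw [hcA, hcH, hcG, hcP] at key
  rw [eΨl, eΨh]
  linarith [key, a1, a2]

/-- **THE UNIFORM SHARE**: the same with the shares `(σ, 1 − σ)`, `0 ≤ σ ≤ 1` — the SHARE criterion `w₀/D₀ + w₁/D₁ ≤ 1` of memo ARCH-G60 §1 (take `σ = w₀/D₀`).
[this work] -/
theorem gluedPullback_windowPair_twoRow_mid_of_share (x a q g S : ℝ) (B r k j l h c ls : ℕ) (α p : ℕ → ℝ) (ι σ : ℝ)
    (ϖ0A ϖ0H ϖ0G ϖ0P ϖ1A ϖ1H ϖ1G ϖ1P : ℝ)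
    (hx0 : 0 < x) (hx1 : x < 1) (ha0 : 0 < a) (ha1 : a ≤ 1) (hq0 : 0 < q) (hq1 : q < 1) (hg0 : 0 ≤ g) (hg1 : g ≤ 1) (hr : 1 ≤ r)
    (hlh : l < h) (hhB : h ≤ B) (hwin : j < h + r + k) (hlow : 2 * (l : ℝ) < a * S) (hcomp : a * S < (l : ℝ) + h)
    (hL2j : l + r + k ≤ j) (hL2mid : a * (S + q * ((r : ℝ) + k * g)) ≤ 2 * ((l : ℝ) + r + k))
    (hL1low : 2 * ((l : ℝ) + r) < a * (S + q * ((r : ℝ) + k * g))) (hhmid : a * (S + q * ((r : ℝ) + k * g)) ≤ 2 * (h : ℝ))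
    (hι : (h + r ≤ j ∧ ι = 0) ∨ (j < h + r ∧ ι = 1))
    (hhc : h ≤ c) (hcB : c ≤ B) (hcj : c ≤ j)
    (hp : ∀ h, 0 ≤ p h)
    (hαp : ∀ l' h', l' ≤ j → 2 * (l' : ℝ) < a * (S + q * ((r : ℝ) + k * g)) → h' ≤ B + (r + k) →
      (j + 1 ≤ h' ∨ a * (S + q * ((r : ℝ) + k * g)) < (l' : ℝ) + h') →
      α l' ≤ usage (a * x) (a * (S + q * ((r : ℝ) + k * g))) j l' h' * p h')
    (hcheap : -(gluedPullback (a * (S + q * ((r : ℝ) + k * g))) q g j r k α p c) * (a * x)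
      < (1 - a * x) * gluedPullback (a * (S + q * ((r : ℝ) + k * g))) q g j r k α p ls)
    (hσ0 : 0 ≤ σ) (hσ1 : σ ≤ 1)
    (hϖ0A : 0 ≤ ϖ0A) (hϖ0H : 0 ≤ ϖ0H) (hϖ0G : 0 ≤ ϖ0G) (hϖ0P : 0 ≤ ϖ0P) (hϖ1A : 0 ≤ ϖ1A) (hϖ1H : 0 ≤ ϖ1H) (hϖ1G : 0 ≤ ϖ1G) (hϖ1P : 0 ≤ ϖ1P)
    (hv0A : ϖ0A * usage (a * x) (a * (S + q * ((r : ℝ) + k * g))) j l (l + r + k) ≤ 1)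
    (hc0A : ϖ0A = 0 ∨ a * (S + q * ((r : ℝ) + k * g)) < (l : ℝ) + ((l : ℝ) + r + k))
    (hv0H : ϖ0H * usage (a * x) (a * (S + q * ((r : ℝ) + k * g))) j l h ≤ 1)
    (hc0H : ϖ0H = 0 ∨ a * (S + q * ((r : ℝ) + k * g)) < (l : ℝ) + h)
    (hv0G : ϖ0G * usage (a * x) (a * (S + q * ((r : ℝ) + k * g))) j l (h + r) ≤ 1)
    (hc0G : ϖ0G = 0 ∨ j < h + r ∨ a * (S + q * ((r : ℝ) + k * g)) < (l : ℝ) + ((h : ℝ) + r))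
    (hv0P : ϖ0P * ((a * x) / (1 - a * x)) ≤ 1 ∨
      (a * (S + q * ((r : ℝ) + k * g)) < (l : ℝ) + h ∧ ϖ0P * usage (a * x) (a * (S + q * ((r : ℝ) + k * g))) j l h ≤ 1))
    (hv1A : ϖ1A * usage (a * x) (a * (S + q * ((r : ℝ) + k * g))) j (l + r) (l + r + k) ≤ 1)
    (hc1A : ϖ1A = 0 ∨ a * (S + q * ((r : ℝ) + k * g)) < ((l : ℝ) + r) + ((l : ℝ) + r + k))
    (hv1H : ϖ1H * usage (a * x) (a * (S + q * ((r : ℝ) + k * g))) j (l + r) h ≤ 1)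
    (hc1H : ϖ1H = 0 ∨ a * (S + q * ((r : ℝ) + k * g)) < ((l : ℝ) + r) + h)
    (hv1G : ϖ1G * usage (a * x) (a * (S + q * ((r : ℝ) + k * g))) j (l + r) (h + r) ≤ 1)
    (hc1G : ϖ1G = 0 ∨ j < h + r ∨ a * (S + q * ((r : ℝ) + k * g)) < ((l : ℝ) + r) + ((h : ℝ) + r))
    (hv1P : ϖ1P * ((a * x) / (1 - a * x)) ≤ 1 ∨
      (a * (S + q * ((r : ℝ) + k * g)) < ((l : ℝ) + r) + h ∧ ϖ1P * usage (a * x) (a * (S + q * ((r : ℝ) + k * g))) j (l + r) h ≤ 1))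
    (hcov0 : (1 - pairGate (a * x) (a * S) l h) * (1 - q)
      ≤ σ * ((1 - pairGate (a * x) (a * S) l h) * (q * g) * ϖ0A + pairGate (a * x) (a * S) l h * (1 - q) * ϖ0H
        + pairGate (a * x) (a * S) l h * (q * (1 - g)) * (1 - ι) * ϖ0G + pairGate (a * x) (a * S) l h * (q * g + ι * (q * (1 - g))) * ϖ0P))
    (hcov1 : (1 - pairGate (a * x) (a * S) l h) * (q * (1 - g))
      ≤ (1 - σ) * ((1 - pairGate (a * x) (a * S) l h) * (q * g) * ϖ1A + pairGate (a * x) (a * S) l h * (1 - q) * ϖ1H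
        + pairGate (a * x) (a * S) l h * (q * (1 - g)) * (1 - ι) * ϖ1G + pairGate (a * x) (a * S) l h * (q * g + ι * (q * (1 - g))) * ϖ1P)) :
    (1 - pairGate (a * x) (a * S) l h) * gluedPullback (a * (S + q * ((r : ℝ) + k * g))) q g j r k α p l
      + pairGate (a * x) (a * S) l h * gluedPullback (a * (S + q * ((r : ℝ) + k * g))) q g j r k α p h ≤ 0 :=
  gluedPullback_windowPair_twoRow_mid_of_assign x a q g S B r k j l h c ls α p ι ϖ0A ϖ0H ϖ0G ϖ0P ϖ1A ϖ1H ϖ1G ϖ1P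
    σ σ σ σ (1 - σ) (1 - σ) (1 - σ) (1 - σ) hx0 hx1 ha0 ha1 hq0 hq1 hg0 hg1 hr hlh hhB hwin hlow hcomp hL2j hL2mid hL1low hhmid hι
    hhc hcB hcj hp hαp hcheap hϖ0A hϖ0H hϖ0G hϖ0P hϖ1A hϖ1H hϖ1G hϖ1P hσ0 hσ0 hσ0 hσ0
    (by linarith) (by linarith) (by linarith) (by linarith) (by linarith) (by linarith) (by linarith) (by linarith)
    hv0A hc0A hv0H hc0H hv0G hc0G hv0P hv1A hc1A hv1H hc1H hv1G hc1G hv1P (by linarith [hcov0]) (by linarith [hcov1])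

end LawDec
end Quant
end Summit.CriticalPhenomena.PercolationContinuityZ3.Theorems
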